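import Summits.ResolutionOfSingularities.ResolutionOfSingularities.Theorems.HilbertSamuelEliminationSigmaMaxModificationsCorridor3WLadderStrataHalfPrinted
import Summits.ResolutionOfSingularities.ResolutionOfSingularities.Theorems.HilbertSamuelEliminationSigmaMaxModificationsCorridor3WLadderStrataCentreCurveDominantCleanGeomDir
import Summits.ResolutionOfSingularities.ResolutionOfSingularities.Theorems.HilbertSamuelEliminationSigmaMaxModificationsCorridor3WLadderMovingTwoCensus2
import Summits.ResolutionOfSingularities.ResolutionOfSingularities.Theorems.HilbertSamuelEliminationSigmaMaxModificationsCorridor3Theorem314PointLocusOfThmIV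
import Literature.AlgebraicGeometry.Resolution.OneDimensionalBlowupTowerProof
import Literature.AlgebraicGeometry.CossartJannsenSaito2020.KeyTheoremsLocalLinks
import HarnessLib

/-!
# [OURS · L1 W4.2] THE STRATA HALF `Wlow3CharStrataM p` FROM FOUR PRINTED NAMED FACTS — every discharge now in the tree applied
# (the `hFf` swap; Thm. 3.6, F-split, Kollár 1.101 are THEOREMS; CJS Thm. 3.14 in all three renderings DERIVED from [H4] Th. IV)

Crux chain w42 (`SigmaMaxModifications`, stmt-ResolutionOfSingularities-18506; conjunct `SigmaMaxModificationsCorridor3`,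
stmt-ResolutionOfSingularities-19249; line v8.3 `w_ladder_elim`, registered stub `stub_Wlow3M_char : ∀ p, p.Prime → Wlow3CharM p`), seat
res-L1-w42-stub-4 (gen 5). OURS (cell res-hironaka, slot W4.2); NOT statements of H. Hironaka's manuscript [Hironaka2017] nor of
[CossartJannsenSaito2020]; AI-drafted, weaker than expert review. PURE COMPOSITIONS by name (no definition); every theorem is proved; the
open content is exactly the PRINTED hypotheses listed (named facts typed in `Literature/`, taken as binders) and, where said, ONE OURS
construction (stub-1's unit recognition). Helper file `--supports stmt-ResolutionOfSingularities-19249`; credits nothing by itself.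

WHAT IS SWAPPED IN (all by name, all in the tree): the near-fibre form of Thm. 3.14 (F-61, binder `hFf`) is res-L1-w42-stub-3's
`Directrix214Sharp.thm314_nearFibre_subsingleton_of_facts` (p525927) over [H4] Th. IV and F-split, and F-split
`HerrmannIkedaOrbanz1988_cor_21_11` is the tree THEOREM `HerrmannIkedaOrbanz1988_cor_21_11_holds` (res-D-lib-1); Thm. 3.6 (F-65, binder `h36`)
is the tree THEOREM `CossartJannsenSaito2020_thm_3_6_holds` (res-type-064, p529537); inside the bundle `LocalChainPrintedFacts`: Kollár's
Thm. 1.101 in local-chain form is the tree THEOREM `Kollar2007_thm_1_101_localChain_holds`, the numerical Thm. 3.14 is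
`cossartJannsenSaito2020_thm_3_14_of_thmIV_of_split` (stub-3) and its point-centre locus form is res-type-031's `thm314_point_locus_of_thmIV`
(p527233), both over [H4] Th. IV. NET PRINTED INPUT OF THE STRATA HALF: **four** named facts — Cor. 6.37 over a local scheme
(`Corollary637_char_loc`), Thm. 6.40 for unit-wise localised chains with isolated initial parts (`KeyTheorem640_char_localized_isolated`,
F-04c), Thm. 3.10 (4) (`CossartJannsenSaito2020_thm_3_10_4`) and [H4] Th. IV (`Hironaka1970_thmIV`, F-51′) — was eight (p528352).

* §1 `localChainPrintedFacts_of_thmIV` — the six-conjunct bundle from the four facts.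
* §2 **`wlow3CharStrataM_of_thmIV : Corollary637_char_loc → KeyTheorem640_char_localized_isolated → CossartJannsenSaito2020_thm_3_10_4 →
  Hironaka1970_thmIV → ∀ p, Wlow3CharStrataM p`** (and the bundle-keyed socket form `wlow3CharStrataM_of_printedFacts_thmIV (hF) (h51)` for
  lead-1's feed `hS`).
* §3 the char row `stub_Wlow3M_char` modulo the four facts, the (F1) global Cor. 6.37 `Corollary637_char` (which GIVES the local form,
  `Corollary637_char.toLoc`) and ONE OURS construction, stub-1's `Seg.UnitRecognitionAtQM p (QCharRegime p)`:
  **`stub_Wlow3M_char_of_thmIV_of_recognition`** — four printed binders + recognition (was nine + recognition).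
* §4 β-twin `WlowStrataM p` (stub-3's socket) from the same four facts: `wlowStrataM_of_thmIV_printedFacts` (the three (F1♯) binders of
  p529462 are stub-3's theorems over [H4] Th. IV).
* §5 row (c-geo) `StrataLineageInCentreIO p 3 Q G` from the four facts (`strataLineageInCentreIO_of_thmIV`; card H composition p527465 over §1).
  (The characteristic-2 census with every strata socket discharged is res-L1-w42-stub-3's `wlow3TwoM_census₅`, p531303 — not repeated.)
* §6 lead-1's crux census (`…ThirdDoorClosed`, skeleton v6 shape) with the strata row fed and the Thm. 3.14 binders derived:
  `Residue.sigmaMaxModificationsCorridor3_of_thmIV_of_four_rows`.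

References: CJS LNM 2270 Thm. 3.6, Thm. 3.10 (4), Thm. 3.14, Thm. 6.35, Cor. 6.37, Def. 6.38, Thm. 6.40, Rem. 6.29 (1), p. 107
[CossartJannsenSaito2020]; Hironaka, Additive groups associated with points of a projective space, Th. IV [Hironaka1970NumericalCharacters];
Kollár 2007 Thm. 1.101 [Kollar2007]; Herrmann–Ikeda–Orbanz Cor. 21.11; tree p528352 / p529462 / p527465 (this seat), p525927 / p526687
(res-L1-w42-stub-3), p527233 (res-type-031), p529537 (res-type-064), p518484 (res-D-lib-1), `…ThirdDoorClosed` (res-L1-w42-lead-1).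
-/

noncomputable section

-- plan-1/idea-2 module setting kept (namespace `…Corridor3.Moving` re-enters `…Corridor3`)
set_option linter.dupNamespace false

open CategoryTheory CategoryTheory.Limits AlgebraicGeometry TopologicalSpace Topology IsLocalRing
open Summit.ResolutionOfSingularities.ResolutionOfSingularities.Theorems.CampaignW42
open Literature.AlgebraicGeometry.Resolution Literature.RingTheory.HilbertSamuel
open Literature.AlgebraicGeometry.CossartJannsenSaito2020
open Summit.ResolutionOfSingularities.ResolutionOfSingularities.Theses.HilbertSamuelElimination
open Summit.ResolutionOfSingularities.ResolutionOfSingularities.Theorems.SigmaMaxModificationsCorridor3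

universe u

namespace Summit.ResolutionOfSingularities.ResolutionOfSingularities.Theorems.SigmaMaxModificationsCorridor3.Moving

/-! ## §1. The printed bundle from four facts -/

/-- **The six-conjunct bundle `LocalChainPrintedFacts` from FOUR printed named facts** — Cor. 6.37 (local form), Thm. 6.40 (unit-wise localised,
isolated), Thm. 3.10 (4) and [H4] Th. IV: the numerical Thm. 3.14 and its point-centre locus form are DERIVED from Th. IV (stub-3 /
res-type-031, F-split being the tree theorem `HerrmannIkedaOrbanz1988_cor_21_11_holds`), and Kollár's Thm. 1.101 (local-chain form) is
the tree theorem `Kollar2007_thm_1_101_localChain_holds`. [cite: CossartJannsenSaito2020, Thm. 3.14, Cor. 6.37, Thm. 6.40, p. 107] -/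
theorem localChainPrintedFacts_of_thmIV (hC : Corollary637_char_loc.{u}) (hK : KeyTheorem640_char_localized_isolated.{u})
    (h310 : CossartJannsenSaito2020_thm_3_10_4.{u}) (h51 : Hironaka1970_thmIV.{u}) : LocalChainPrintedFacts.{u} :=
  ⟨hC, hK, cossartJannsenSaito2020_thm_3_14_of_thmIV_of_split h51 HerrmannIkedaOrbanz1988_cor_21_11_holds, h310,
    Kollar2007_thm_1_101_localChain_holds, Directrix214Sharp.thm314_point_locus_of_thmIV h51⟩

/-! ## §2. The strata half from four printed facts -/

/-- **Socket form for lead-1's feed: the strata half from the bundle and [H4] Th. IV** — p528352's `wlow3CharStrataM_of_printedFacts hF hFf h36`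
with `hFf := thm314_nearFibre_subsingleton_of_thmIV h51` (stub-3; F-split a theorem) and `h36 := CossartJannsenSaito2020_thm_3_6_holds`
(res-type-064). [cite: CossartJannsenSaito2020, Thm. 3.6, Thm. 3.14, Thm. 6.35, Rem. 6.29 (1)] -/
theorem wlow3CharStrataM_of_printedFacts_thmIV (hF : LocalChainPrintedFacts.{0}) (h51 : Hironaka1970_thmIV.{0}) (p : ℕ) :
    Wlow3CharStrataM p :=
  wlow3CharStrataM_of_printedFacts hF (thm314_nearFibre_subsingleton_of_thmIV h51) CossartJannsenSaito2020_thm_3_6_holds p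

/-- **THE STRATA HALF `Wlow3CharStrataM p` FROM FOUR PRINTED NAMED FACTS, NO OURS HYPOTHESIS** — Cor. 6.37 over a local scheme
(`Corollary637_char_loc`), Thm. 6.40 for unit-wise localised chains with isolated initial parts (`KeyTheorem640_char_localized_isolated`),
Thm. 3.10 (4) (`CossartJannsenSaito2020_thm_3_10_4`), [H4] Th. IV (`Hironaka1970_thmIV`). Every other input of p528352's eight (Thm. 3.14
numerical / point locus / near fibre, Kollár 1.101, Thm. 3.6) is a theorem of the tree or derived from Th. IV.
[cite: CossartJannsenSaito2020, Thm. 3.6, Thm. 3.10 (4), Thm. 3.14, Thm. 6.35, Cor. 6.37, Def. 6.38, Thm. 6.40, Rem. 6.29 (1), p. 107] -/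
theorem wlow3CharStrataM_of_thmIV (hC : Corollary637_char_loc.{0}) (hK : KeyTheorem640_char_localized_isolated.{0})
    (h310 : CossartJannsenSaito2020_thm_3_10_4.{0}) (h51 : Hironaka1970_thmIV.{0}) (p : ℕ) : Wlow3CharStrataM p :=
  wlow3CharStrataM_of_printedFacts_thmIV (localChainPrintedFacts_of_thmIV hC hK h310 h51) h51 p

/-- **The strata half as the registered-shape row `∀ p, p.Prime → Wlow3CharStrataM p`** (lead-1's socket `hS`; primality idle).
[cite: CossartJannsenSaito2020, Thm. 3.14, Thm. 6.35, Cor. 6.37, Thm. 6.40] -/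
theorem wlow3CharStrataM_row_of_thmIV (hC : Corollary637_char_loc.{0}) (hK : KeyTheorem640_char_localized_isolated.{0})
    (h310 : CossartJannsenSaito2020_thm_3_10_4.{0}) (h51 : Hironaka1970_thmIV.{0}) : ∀ p : ℕ, p.Prime → Wlow3CharStrataM p :=
  fun p _ => wlow3CharStrataM_of_thmIV hC hK h310 h51 p

/-- **The (F1)-regime strata row in its `MaxOriginNoMovingNearChainAtQ` spelling, from the four facts.**
[cite: CossartJannsenSaito2020, Thm. 3.14, Thm. 6.35, Rem. 6.29 (1)] -/
theorem maxOriginNoMovingNearChainAtQ_charRegime_notIso_of_thmIV (hC : Corollary637_char_loc.{0})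
    (hK : KeyTheorem640_char_localized_isolated.{0}) (h310 : CossartJannsenSaito2020_thm_3_10_4.{0}) (h51 : Hironaka1970_thmIV.{0})
    (p : ℕ) : MaxOriginNoMovingNearChainAtQ.{0} p 3 (Helpers.QCharRegime p) fun s => s.geomDirDim ≤ 2 ∧ ¬ Iso 3 s :=
  wlow3CharStrataM_of_thmIV hC hK h310 h51 p

/-! ## §3. The char row `stub_Wlow3M_char` modulo four printed facts and ONE construction (unit recognition) -/

/-- **THE CHAR ROW `Wlow3CharM p` FROM FOUR PRINTED NAMED FACTS AND ONE OURS CONSTRUCTION** — printed: the (F1) global Cor. 6.37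
`Corollary637_char` (its local form `Corollary637_char_loc` follows, `Corollary637_char.toLoc`), `KeyTheorem640_char_localized_isolated` (F-04c),
`CossartJannsenSaito2020_thm_3_10_4`, `Hironaka1970_thmIV` (F-51′); OURS construction: stub-1's unit recognition
`Seg.UnitRecognitionAtQM p (QCharRegime p)`. Plugs: lead-1's `wlow3CharM_of_printed_of_constructionsLoc` (model (b), `…ThirdDoorClosed`),
stub-1's `unitTowerExtractionLocQM_of_recognition`, §2. CONDITIONAL — credits nothing.
[cite: CossartJannsenSaito2020, Thm. 3.10 (4), Thm. 3.14, Def. 6.34, Thm. 6.35, Cor. 6.37, Def. 6.38, Thm. 6.40, p. 107] -/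
theorem wlow3CharM_of_thmIV_of_recognition (hC637 : Corollary637_char.{0}) (hK : KeyTheorem640_char_localized_isolated.{0})
    (h310 : CossartJannsenSaito2020_thm_3_10_4.{0}) (h51 : Hironaka1970_thmIV.{0}) {p : ℕ}
    (hrec : Seg.UnitRecognitionAtQM p (Helpers.QCharRegime p)) : Wlow3CharM.{0} p :=
  wlow3CharM_of_printedFacts_of_recognition (localChainPrintedFacts_of_thmIV hC637.toLoc hK h310 h51) hC637
    (thm314_nearFibre_subsingleton_of_thmIV h51) CossartJannsenSaito2020_thm_3_6_holds hrec

/-- **The char row over the registered construction name `UnitTowerExtractionLocQM p`** (unit-wise localised extraction, stub-1) and four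
printed facts. [cite: CossartJannsenSaito2020, Thm. 3.14, Cor. 6.37, Thm. 6.40, p. 107] -/
theorem wlow3CharM_of_thmIV_of_extractionLoc (hC637 : Corollary637_char.{0}) (hK : KeyTheorem640_char_localized_isolated.{0})
    (h310 : CossartJannsenSaito2020_thm_3_10_4.{0}) (h51 : Hironaka1970_thmIV.{0}) {p : ℕ}
    (hext : UnitTowerExtractionLocQM p) : Wlow3CharM.{0} p :=
  wlow3CharM_of_printedFacts_of_extractionLoc (localChainPrintedFacts_of_thmIV hC637.toLoc hK h310 h51) hC637
    (thm314_nearFibre_subsingleton_of_thmIV h51) CossartJannsenSaito2020_thm_3_6_holds hext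

/-- **The registered stub `stub_Wlow3M_char : ∀ p, p.Prime → Wlow3CharM p` MODULO FOUR PRINTED FACTS AND UNIT RECOGNITION** — printed:
`Corollary637_char`, `KeyTheorem640_char_localized_isolated`, `CossartJannsenSaito2020_thm_3_10_4`, `Hironaka1970_thmIV`; OURS construction,
for every prime `p`: stub-1's `Seg.UnitRecognitionAtQM p (QCharRegime p)`. The strata half contributes no hypothesis.
[cite: CossartJannsenSaito2020, Thm. 3.10 (4), Thm. 3.14, Thm. 6.35, Cor. 6.37, Thm. 6.40] -/
theorem stub_Wlow3M_char_of_thmIV_of_recognition (hC637 : Corollary637_char.{0}) (hK : KeyTheorem640_char_localized_isolated.{0})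
    (h310 : CossartJannsenSaito2020_thm_3_10_4.{0}) (h51 : Hironaka1970_thmIV.{0})
    (hrec : ∀ p : ℕ, p.Prime → Seg.UnitRecognitionAtQM p (Helpers.QCharRegime p)) : ∀ p : ℕ, p.Prime → Wlow3CharM.{0} p :=
  fun p hp => wlow3CharM_of_thmIV_of_recognition hC637 hK h310 h51 (hrec p hp)

/-- **The registered stub over the registered construction name** `UnitTowerExtractionLocQM p` at every prime.
[cite: CossartJannsenSaito2020, Thm. 3.14, Cor. 6.37, Thm. 6.40] -/
theorem stub_Wlow3M_char_of_thmIV_of_extractionLoc (hC637 : Corollary637_char.{0}) (hK : KeyTheorem640_char_localized_isolated.{0})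
    (h310 : CossartJannsenSaito2020_thm_3_10_4.{0}) (h51 : Hironaka1970_thmIV.{0})
    (hext : ∀ p : ℕ, p.Prime → UnitTowerExtractionLocQM p) : ∀ p : ℕ, p.Prime → Wlow3CharM.{0} p :=
  fun p hp => wlow3CharM_of_thmIV_of_extractionLoc hC637 hK h310 h51 (hext p hp)

/-! ## §4. The β-twin `WlowStrataM p` from the same four printed facts -/

/-- **β-twin: `WlowStrataM p` (stub-3's socket `hS`, every prime and every origin) FROM FOUR PRINTED NAMED FACTS** — p529462's
`wlowStrataM_of_geomDir_printedFacts` with its three (F1♯) binders supplied by stub-3's theorems over [H4] Th. IV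
(`theorem314_geomDir_of_thmIV_of_split`, `theorem314_nearFibre_geomDir_of_thmIV`, `thm314_point_locus_geomDir_of_thmIV_point`), the bundle by
§1 and Thm. 3.6 by its tree proof. NO OURS hypothesis. [cite: CossartJannsenSaito2020, Thm. 3.6, Thm. 3.14, Def. 6.38 (ii), Thm. 6.35, Rem. 6.29 (1)] -/
theorem wlowStrataM_of_thmIV_printedFacts (hC : Corollary637_char_loc.{0}) (hK : KeyTheorem640_char_localized_isolated.{0})
    (h310 : CossartJannsenSaito2020_thm_3_10_4.{0}) (h51 : Hironaka1970_thmIV.{0}) (p : ℕ) : WlowStrataM p :=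
  wlowStrataM_of_geomDir_printedFacts
    (Directrix214Sharp.theorem314_geomDir_of_thmIV_of_split h51 HerrmannIkedaOrbanz1988_cor_21_11_holds)
    (theorem314_nearFibre_geomDir_of_thmIV h51)
    (Directrix214Sharp.thm314_point_locus_geomDir_of_thmIV_point (Hironaka1970_thmIV_point_of_thmIV h51))
    (localChainPrintedFacts_of_thmIV hC hK h310 h51) CossartJannsenSaito2020_thm_3_6_holds p

/-- **The `Q`-generic strata row from the four facts** (any origin predicate `Q`).
[cite: CossartJannsenSaito2020, Thm. 3.6, Thm. 3.14, Def. 6.38 (ii), Rem. 6.29 (1)] -/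
theorem maxOriginNoMovingNearChainAtQ_notIso_of_thmIV {p : ℕ} (Q : ℕ → (ℕ → ℕ) → ∀ X : Scheme.{0}, X → Prop)
    (hC : Corollary637_char_loc.{0}) (hK : KeyTheorem640_char_localized_isolated.{0})
    (h310 : CossartJannsenSaito2020_thm_3_10_4.{0}) (h51 : Hironaka1970_thmIV.{0}) :
    MaxOriginNoMovingNearChainAtQ p 3 Q fun s => s.geomDirDim ≤ 2 ∧ ¬ Iso 3 s :=
  maxOriginNoMovingNearChainAtQ_notIso_of_geomDir_printedFacts
    (Directrix214Sharp.theorem314_geomDir_of_thmIV_of_split h51 HerrmannIkedaOrbanz1988_cor_21_11_holds)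
    (theorem314_nearFibre_geomDir_of_thmIV h51)
    (Directrix214Sharp.thm314_point_locus_geomDir_of_thmIV_point (Hironaka1970_thmIV_point_of_thmIV h51))
    (localChainPrintedFacts_of_thmIV hC hK h310 h51) CossartJannsenSaito2020_thm_3_6_holds

/-! ## §5. Row (c-geo) from the four facts (every prime, every origin predicate, every grade) -/

/-- **ROW (c-geo) for every `p`, ALL ORIGINS, from the four facts** (card H composition, p527465, over §1).
[cite: CossartJannsenSaito2020, Lemma 6.30, p. 98 Step 9, Cor. 6.37, Thm. 6.40, p. 107] -/
theorem strataLineageInCentreIO_of_thmIV (hC : Corollary637_char_loc.{u}) (hK : KeyTheorem640_char_localized_isolated.{u})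
    (h310 : CossartJannsenSaito2020_thm_3_10_4.{u}) (h51 : Hironaka1970_thmIV.{u}) (p : ℕ)
    (Q : ℕ → (ℕ → ℕ) → ∀ X : Scheme.{u}, X → Prop) (G : MarkedStage.{u} → Prop) : StrataLineageInCentreIO.{u} p 3 Q G :=
  strataLineageInCentreIO_of_printedFacts (localChainPrintedFacts_of_thmIV hC hK h310 h51) p Q G

end Summit.ResolutionOfSingularities.ResolutionOfSingularities.Theorems.SigmaMaxModificationsCorridor3.Moving

/-! ## §6. The crux conjunct with the strata row fed (skeleton `w_ladder` v6 census shape of `…ThirdDoorClosed`) -/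

namespace Summit.ResolutionOfSingularities.ResolutionOfSingularities.Theorems.SigmaMaxModificationsCorridor3.Residue

open Summit.ResolutionOfSingularities.ResolutionOfSingularities.Theorems.SigmaMaxModificationsCorridor3.Moving

/-- **THE CRUX CONJUNCT `SigmaMaxModificationsCorridor3` FROM PRINT AND FOUR OURS ROWS, Thm. 3.14 binders derived** — lead-1's
`sigmaMaxModificationsCorridor3_of_printed_of_rows` (v6 census) with the strata row `∀ p, p.Prime → Wlow3CharStrataM p` FED by §2 and the numerical /
point-locus Thm. 3.14 binders DERIVED from [H4] Th. IV. Printed binders left: `ν`-elimination of surfaces, CJS sequences permissible, Thm. 3.10 (4),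
Thm. 6.40 (F1, isolated; and its unit-wise localised form), Cor. 6.37 (F1), [H4] Th. IV. Remaining OURS rows: `UnitTowerExtractionQM`, `Wlow3TwoM`,
`Wtop3PointedM`, `Wtop3NonpointedM`. CONDITIONAL — credits nothing. [cite: CossartJannsenSaito2020, Thm. 1.2, Thm. 3.10 (4), Thm. 3.14, Cor. 6.37, Thm. 6.40] -/
theorem sigmaMaxModificationsCorridor3_of_thmIV_of_four_rows
    (hNu : CossartJannsenSaito2020_nuElimination.{0}) (hSeq : CossartJannsenSaito2020SequencePermissible.{0})
    (h310 : CossartJannsenSaito2020_thm_3_10_4.{0}) (hK : KeyTheorem640_char_isolated.{0})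
    (hKl : KeyTheorem640_char_localized_isolated.{0}) (hC : Corollary637_char.{0}) (h51 : Hironaka1970_thmIV.{0})
    (hU : ∀ p : ℕ, p.Prime → UnitTowerExtractionQM p) (hTwo : ∀ p : ℕ, p.Prime → Wlow3TwoM.{0} p)
    (hTopP : ∀ p : ℕ, p.Prime → Wtop3PointedM.{0} p) (hTopN : ∀ p : ℕ, p.Prime → Wtop3NonpointedM.{0} p) :
    SigmaMaxModificationsCorridor3 :=
  sigmaMaxModificationsCorridor3_of_printed_of_rows hNu hSeq h310 hK hC
    (cossartJannsenSaito2020_thm_3_14_of_thmIV_of_split h51 HerrmannIkedaOrbanz1988_cor_21_11_holds)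
    (Directrix214Sharp.thm314_point_locus_of_thmIV h51) hU (wlow3CharStrataM_row_of_thmIV hC.toLoc hKl h310 h51) hTwo hTopP hTopN

end Summit.ResolutionOfSingularities.ResolutionOfSingularities.Theorems.SigmaMaxModificationsCorridor3.Residue

end
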